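import Literature.AlgebraicGeometry.Frobenioids.MotivatingExamplesSub
import Literature.AlgebraicGeometry.Frobenioids.MotivatingExamplesSubGeomHypothesesFSM
import Literature.AlgebraicGeometry.Frobenioids.FinSubextCatPadicNotFSMFF
import Literature.AlgebraicGeometry.Frobenioids.GeometricDivisorDataWitness
import HarnessLib

/-!
# Frobenioids I, §6 sub-DAG, row T62iii/L06 `Thm62iii_L06_standard` ("hence `C` is of standard type"):
# the universal closure AS TYPED (no `K̃/K` Galois) is FALSE; FSM-type of the base category suffices

Mochizuki, *The geometry of Frobenioids I: the general theory*, Kyushu J. Math. **62** (2008) 293–400,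
Theorem 6.2 (iii) p. 111 and its proof p. 111 l. 30 – p. 112 l. 4: "It is immediate that every monomorphism of `D`
is an isomorphism, hence that `D` is of FSM-type [hence also of FSMFF-type — cf. §0] … thus, we conclude that `Φ`
is non-dilating, hence that `C` is of standard type" (Def. 3.1 (i) p. 56: standard type = quasi-isotropic and
Frobenius-isotropic, Frobenius-compact if group-like, Frobenius-normalized, **`D` of FSMFF-type**, `Φ`
non-dilating); Example 6.1 p. 109 fixes "`K̃` a Galois extension of `K`". [cite: MochizukiFrdI2008, Thm. 6.2 (iii) p.111]
[cite: MochizukiFrdI2008, Def. 3.1 (i) p.56]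

PROOF-ONLY companion (cell abc-iut, block F fact-proving wave, seat abc-iut-f-043; FACT-LIST row F-1137
`Thm62iii_L06_standard` of `plan/FACT-LIST.md`, `kernel_closedness = parametrised`, R7-demoted to "proved at
named instance families only"). No definitions, nothing re-typed; the declaring file `MotivatingExamplesSub.lean`
is imported, never edited.

WHAT THE KERNEL RECORDS. The row `Thm62iii_L06_standard (Γ : GeometricDivisorData K Kt) :=
(geomFrobenioidOps Γ).IsOfStandardType` is typed over an ARBITRARY extension `Kt/K`.
* Clause (d) of standard type is a property of the BASE CATEGORY alone: `Thm62iii_L06_standard Γ` implies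
  `IsOfFSMFFType (FinSubextCat K Kt)` (`isOfFSMFFType_of_Thm62iii_L06_standard`), for any `Γ`.
* For `K = ℚ ⊆ Kt = ℚ_17` the base category is NOT of FSMFF-type (`FinSubextCat.not_isOfFSMFFType_rat_padic`,
  `FinSubextCatPadicNotFSMFF.lean`: the rigid sextic `ℚ((5+2√2)^{1/3}) ⊇ ℚ(√2)` inside `ℚ_17`), and every
  extension carries an interface datum (abc-iut's landed `GeometricDivisorData.nonempty_geometricDivisorData`,
  `GeometricDivisorDataWitness.lean`), so **the universal closure is false** (`not_forall_Thm62iii_L06_standard`) — indeed over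
  `ℚ_17/ℚ` the row fails for EVERY `Γ` (`not_Thm62iii_L06_standard_rat_padic`).
* Conversely the printed inference only needs `D` of FSM-type: `Thm62iii_L06_standard_of_isOfFSMType` (Thm. 5.2
  (iii) `ModelFrobenioid.standardTypeIff_holds` over abc-iut-f-043's `geom_hypotheses_of_isOfFSMType`, with
  abc-iut-L6-t10's Galois-free `not_isZeroMonoid_geom` and `geomDivisorFunctor_isNonDilatingOn`); the Galois case
  is the landed instance form `Thm62iii_L06_standard_holds` (`GeometricFrobenioidStandard.lean`, cited not
  restated).
So F-1137 is: universal closure REFUTED; instance form (Galois, as printed — more generally `D` of FSM-type)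
PROVED; consumers keep `[IsGalois K Kt]`. Nothing here bears on [IUTchIII] Cor. 3.12 or asserts anything about abc.
-/

noncomputable section

namespace Literature.AlgebraicGeometry.Frobenioids

open CategoryTheory Opposite

section AnyExtension

variable {K : Type} [Field K] {Kt : Type} [Field Kt] [Algebra K Kt]

/-- **Clause (d) of "standard type" is a property of the base category alone**: T62iii/L06 for any `Γ` forces
`D = FinSubextCat K Kt` to be of FSMFF-type (Def. 3.1 (i)(d)). [cite: MochizukiFrdI2008, Def. 3.1 (i) p.56] -/
theorem isOfFSMFFType_of_Thm62iii_L06_standard (Γ : GeometricDivisorData K Kt)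
    (h : Thm62iii_L06_standard Γ) : IsOfFSMFFType (FinSubextCat K Kt) :=
  PreFrobenioidData.IsOfStandardType.fsmff h

/-- If `D` is not of FSMFF-type, T62iii/L06 fails for EVERY interface datum `Γ`.
[cite: MochizukiFrdI2008, Thm. 6.2 (iii) p.111] -/
theorem not_Thm62iii_L06_standard_of_not_isOfFSMFFType (hD : ¬ IsOfFSMFFType (FinSubextCat K Kt))
    (Γ : GeometricDivisorData K Kt) : ¬ Thm62iii_L06_standard Γ :=
  fun h => hD (isOfFSMFFType_of_Thm62iii_L06_standard Γ h)

/-- **T62iii/L06 for EVERY `Γ` when `D` is of FSM-type** — the property the printed proof actually invokes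
(p. 111 "hence `D` is of FSM-type [hence also of FSMFF-type]"): Thm. 5.2 (iii) (`ModelFrobenioid.standardTypeIff_holds`)
over abc-iut-f-043's `geom_hypotheses_of_isOfFSMType`, clauses (a) vacuous (`not_isZeroMonoid_geom`),
(b) `IsOfFSMType.isOfFSMFFType`, (c) `geomDivisorFunctor_isNonDilatingOn`; the Galois case is
`Thm62iii_L06_standard_holds`. [cite: MochizukiFrdI2008, Thm. 6.2 (iii) p.111] -/
theorem Thm62iii_L06_standard_of_isOfFSMType (hD : IsOfFSMType (FinSubextCat K Kt))
    (Γ : GeometricDivisorData K Kt) : Thm62iii_L06_standard Γ := by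
  unfold Thm62iii_L06_standard
  rw [show geomFrobenioidOps Γ = ModelFrobenioid.data _ _ _ from ModelFrobenioid.ofModel_eq_data _ _ _]
  exact (ModelFrobenioid.standardTypeIff_holds _ _ _ (geom_hypotheses_of_isOfFSMType hD Γ)).mpr
    ⟨fun h0 => (not_isZeroMonoid_geom Γ h0).elim, hD.isOfFSMFFType, geomDivisorFunctor_isNonDilatingOn Γ⟩

end AnyExtension

/-- **Over `ℚ_17/ℚ`, T62iii/L06 fails for every interface datum** (the base category is not of FSMFF-type).
[cite: MochizukiFrdI2008, Thm. 6.2 (iii) p.111] -/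
theorem not_Thm62iii_L06_standard_rat_padic [Fact (Nat.Prime 17)] (Γ : GeometricDivisorData ℚ ℚ_[17]) :
    ¬ Thm62iii_L06_standard Γ :=
  not_Thm62iii_L06_standard_of_not_isOfFSMFFType FinSubextCat.not_isOfFSMFFType_rat_padic Γ

/-- **F-1137, universal closure AS TYPED (no Galois hypothesis) is false**: over `K = ℚ ⊆ K̃ = ℚ_17` the base
category `D` is not of FSMFF-type, so clause (d) of "standard type" fails for the (trivial, or any) interface
datum. The printed instance form (`K̃/K` Galois) is `Thm62iii_L06_standard_holds`; FSM-type of `D` suffices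
(`Thm62iii_L06_standard_of_isOfFSMType`). [cite: MochizukiFrdI2008, Thm. 6.2 (iii) p.111] -/
theorem not_forall_Thm62iii_L06_standard :
    ¬ ∀ {K : Type} [Field K] {Kt : Type} [Field Kt] [Algebra K Kt] (Γ : GeometricDivisorData K Kt),
        Thm62iii_L06_standard Γ := by
  intro h
  haveI : Fact (Nat.Prime 17) := ⟨by decide⟩
  obtain ⟨Γ⟩ := GeometricDivisorData.nonempty_geometricDivisorData ℚ ℚ_[17]
  exact not_Thm62iii_L06_standard_rat_padic Γ (h Γ)

end Literature.AlgebraicGeometry.Frobenioids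

end
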